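import Mathlib
import HarnessLib
import Literature.MathematicalPhysics.StatisticalMechanics.LennardJonesClusters
import Literature.MathematicalPhysics.StatisticalMechanics.LennardJonesThermodynamicLimitProofs
import Summits.AtomisticToContinuum.Crystallization.Theorems.LoopTunnelDialLocalSurgery
import Summits.AtomisticToContinuum.Crystallization.Theorems.LoopTunnelDialOrderOneRung

/-!
# LoopTunnelDial — the ORDER-`k` RUNG of the NEAR surgery floor on crux `PocketCase` (stmt-AtomisticToContinuum-27294):
CAGED VOIDS are local improvements; μ-rigid configurations carry none

decomp-a2c lens-5 «finite/base range + asymptotic regime + bridge», generation 23 (an ATTACK generation, critic row 314);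
`--supports stmt-AtomisticToContinuum-27294 --as helper`.  Sorry-free, NO new definitions (D-0009: every texture below is written
UNFOLDED over Literature's `interactionEnergy` / `siteEnergy` / `lennardJones`; the line file recovers its `MuStable` / `Improvable` /
`FloorEvI` / `RigidNearPocket0`-on-a-class by `Iff.rfl`), imports only landed GS-free modules.

THE RUNG.  The landed ORDER-ONE rung (`LoopTunnelDialOrderOneRung.orderOne_floor`, `LoopTunnelDialLocalSurgery.cagedCount_le_of_muStable`)
fills ONE caged hole (an empty `9/10`-clear point with `≥ 10` particles in the contact window `[39/40, 103/100]`: vacancy 12, divacancy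
site 11, trivacancy site 10).  A site of a LARGER vacancy cluster has fewer than `10` particle contacts (tetra-vacancy site `9`, octahedral
6-void site `8`, vacancy row `10`, vacancy disc centre `6`) and is invisible at order one.  Here the MULTI-SITE insertion is certified:

  «CAGED `k`-VOID within `R` of `y c`» :≡ hole points `q : Fin k → E3`, `1 ≤ k ≤ ⌈64R³⌉`, each within `R` of `y c`, each `9/10`-clear of
  ALL particles, pairwise `≥ 9/10` apart, with   `20·k ≤ 2·P + D`,   where
  `P := Σ_i #{m : |q_i − y_m| ∈ [39/40, 103/100]}` (hole–particle window contacts) and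
  `D := Σ_i #{l ≠ i : |q_i − q_l| ∈ [39/40, 103/100]}` (ORDERED hole–hole window contacts).

* `improvable_of_cagedVoid` (§3, configuration-wise, GS-free): at any level `e ≥ −0.78647722` (the landed two-cone floor) and margin
  `η ≤ 1/100`, filling the whole void — the configuration `Fin.append q y` on `k + N` particles — is a radius-`R` IMPROVEMENT by `η`
  about `y c` in the landed local-surgery currency: `𝓔(q ⧺ y) = 𝓔(y) + 𝓔(q) + Σ_i Σ_m V(|q_i − y_m|)` (Literature `interactionEnergy_append`),
  `Σ_i Σ_m V ≤ −(2/25)·P` (landed `insertion_le_of_clear` per hole), `2·𝓔(q) ≤ −(2/25)·D` (§1–§2: the same window bound over the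
  clear index sets `univ.erase i`), hence `𝓔(q ⧺ y) − 𝓔(y) ≤ −(1/25)(2P + D) ≤ −(4/5)k ≤ e·k − η` as `(4/5 − 0.78647722)·k ≥ 0.0135·k > 1/100`.
* `holes_card_le` (§3): for `R ≥ 1` the budget `k ≤ ⌈64R³⌉` is AUTOMATIC (Literature's volume packing bound
  `card_le_of_separated_of_dist_le`: `k ≤ (20R/9 + 1)³ ≤ (29/9)³R³ < 64R³`).
* `void_floor` (§4, sequence level, GS-free): for EVERY sequence of injective configurations, margin `1/100`, from radius `1` on, at every
  index, a caged void (any `k ≥ 1`) within `R` of some particle makes the configuration radius-`R` improvable by `1/100` about that particle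
  — LITERALLY the line's `FloorEvI x trig` for the sub-trigger `trig R N y := ∃ c, «caged void within R of y c»`; by the line's `floorEvI_mono`
  NEAR♯ restricted to near pockets carrying a caged void is THEREBY PROVED (the vacancy-CLUSTER texture of the NEAR world).
* `twoP_add_D_lt_of_muStable` / `rigid_void_seat` (§5, the μ-SEAT reading = the named typed special case of the line's `RigidNearPocket0`
  on the caged-void class): an `(e, 1/(j+1), j)`-μ-stable injective configuration, `j ≥ max ⌈64R³⌉ 100`, `e` a limit of `E(N)/N`, has ALL its
  `k`-voids within `R` of a particle UNDER-CAGED: `2P + D < 20k` (order one = the landed `k = 1` case `P ≤ 9`); along a sequence: at order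
  `j₀ = max ⌈64R³⌉ 100`, at EVERY index (not only eventually), μ-stability excludes every caged void of radius `R` — without any `UnderQ` hypothesis.
* §6 (the other Kossel relation under the sharper level): IF the level satisfies `e ≤ −0.7175` (in the tree: `e = e⋆`,
  `LoopTunnelDialCurrencyBridge.e_eq_eStar`, and `e⋆ ≤ −0.7175`, `OnePercentFccWindow.eStar_le` — a `native_decide` certificate, therefore kept
  as a HYPOTHESIS here to stay on the axiom whitelist), then μ-stability of any order `j ≥ 1` with tolerance `ε` bounds EVERY site energy by
  `−0.7175 + ε`: every particle of a μ-rigid configuration binds by more than `0.7175 − ε` (`≥ 98.6 %` of `|e⋆| ≤ 0.7865·…` at `ε = 1/100`) — WARM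
  sites, not only hot ones (`𝓔ⁱ ≥ 1/100`), are excluded.

CERTIFIED REACH (stated, not claimed beyond): in a full-shell environment (`12 − h_i` particle contacts at a hole with `h_i` hole neighbours)
`2P + D = 24k − D`, so the certificate fires iff the void's mean internal coordination `D/k ≤ 4`: every void of `≤ 6` sites (tetrahedral 3,
octahedral 4), vacancy rows (2) and strips, small (111) vacancy discs (7-disc: `2P + D = 144 ≥ 140`); it does NOT fire on compact voids of
mean internal coordination `> 4` (13-site cuboctahedral void: `240 < 260`) — the truncated window cannot price a large sealed cavity, whose
filling gain is surface-order while the neglected tails are volume-order: that asymptotic regime (large voids ↔ the crystalline far field) is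
the residual this rung locates, not one it touches.

§1 window sums over clear index sets · §2 hole clusters: self-energy and cross terms · §3 `improvable_of_cagedVoid`, `holes_card_le` ·
§4 `void_floor` · §5 μ-seat: `twoP_add_D_lt_of_muStable`, `rigid_void_seat` · §6 warm sites under `e ≤ −0.7175`.
-/

open scoped BigOperators Classical Topology
open Filter
open Literature.MathematicalPhysics.StatisticalMechanics
open Summit.AtomisticToContinuum.Crystallization.Theorems.GrainPercolationDialCrossCeiling (E3)
open Summit.AtomisticToContinuum.Crystallization.Theorems.LoopTunnelDialLocalSurgery

namespace Summit.AtomisticToContinuum.Crystallization.Theorems.LoopTunnelDialVoidRung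

variable {N : ℕ}

/-! ## §1 Window sums over clear index sets -/

/-- **Window bound over a clear index set (PROVED, GS-free):** if `9/10 ≤ r l` for every `l ∈ S`, then
`Σ_{l ∈ S} V(r l) ≤ −(2/25)·#{l ∈ S : 39/40 ≤ r l ≤ 103/100}` (each window term `≤ −2/25`, every other term `≤ 0`). -/
theorem sum_lennardJones_le_window_card {ι : Type*} (S : Finset ι) (r : ι → ℝ) (hclear : ∀ l ∈ S, 9 / 10 ≤ r l) :
    ∑ l ∈ S, lennardJones (r l) ≤ -(2 / 25) * ((S.filter fun l => 39 / 40 ≤ r l ∧ r l ≤ 103 / 100).card : ℝ) := by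
  -- `V_LJ ≤ 0` beyond `9/10` ((10/9)⁶ < 2), as a local fact (the tree holds it only inside a route-cone module)
  have lennardJones_nonpos_of_ge : ∀ {r : ℝ}, 9 / 10 ≤ r → lennardJones r ≤ 0 := by
    intro r hr
    unfold lennardJones
    have h0 : 0 < r := by linarith
    have hinv : r⁻¹ ≤ (9 / 10 : ℝ)⁻¹ := inv_anti₀ (by norm_num) hr
    have hinv0 : 0 ≤ r⁻¹ := inv_nonneg.2 h0.le
    have ht : (r⁻¹) ^ 6 ≤ ((9 / 10 : ℝ)⁻¹) ^ 6 := pow_le_pow_left₀ hinv0 hinv 6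
    have h2 : ((9 / 10 : ℝ)⁻¹) ^ 6 < 2 := by norm_num
    have h12 : (r⁻¹) ^ 12 = ((r⁻¹) ^ 6) ^ 2 := by ring
    rw [h12]
    nlinarith [pow_nonneg hinv0 6]
  rw [← Finset.sum_filter_add_sum_filter_not S (fun l => 39 / 40 ≤ r l ∧ r l ≤ 103 / 100)]
  have h1 : ∑ l ∈ S.filter (fun l => 39 / 40 ≤ r l ∧ r l ≤ 103 / 100), lennardJones (r l) ≤
      ∑ l ∈ S.filter (fun l => 39 / 40 ≤ r l ∧ r l ≤ 103 / 100), (-(2 / 25) : ℝ) := by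
    refine Finset.sum_le_sum fun l hl => ?_
    have hl' := (Finset.mem_filter.1 hl).2
    exact lennardJones_le_of_window hl'.1 hl'.2
  have h2 : ∑ l ∈ S.filter (fun l => ¬ (39 / 40 ≤ r l ∧ r l ≤ 103 / 100)), lennardJones (r l) ≤ 0 :=
    Finset.sum_nonpos fun l hl => lennardJones_nonpos_of_ge (hclear l (Finset.mem_filter.1 hl).1)
  rw [Finset.sum_const, nsmul_eq_mul] at h1
  linarith

/-! ## §2 Hole clusters: self-energy and cross terms -/

/-- **Self-energy of a `9/10`-separated hole cluster (PROVED, GS-free):** `2·𝓔(q) ≤ −(2/25)·D`, `D` the number of ORDERED pairs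
`(i, l)`, `l ≠ i`, with `|q_i − q_l| ∈ [39/40, 103/100]`. -/
theorem two_mul_interactionEnergy_le_of_sep {k : ℕ} (q : Fin k → E3) (hsep : ∀ i l : Fin k, i ≠ l → 9 / 10 ≤ dist (q i) (q l)) :
    2 * interactionEnergy lennardJones q ≤ -(2 / 25) *
      ((∑ i : Fin k, ((Finset.univ.erase i).filter fun l : Fin k =>
        39 / 40 ≤ dist (q i) (q l) ∧ dist (q i) (q l) ≤ 103 / 100).card : ℕ) : ℝ) := by
  rw [two_mul_interactionEnergy lennardJones q]
  have h : ∀ i : Fin k, siteEnergy lennardJones q i ≤ -(2 / 25) *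
      (((Finset.univ.erase i).filter fun l : Fin k => 39 / 40 ≤ dist (q i) (q l) ∧ dist (q i) (q l) ≤ 103 / 100).card : ℝ) := by
    intro i
    unfold siteEnergy
    exact sum_lennardJones_le_window_card (Finset.univ.erase i) (fun l => dist (q i) (q l))
      fun l hl => hsep i l (Ne.symm (Finset.mem_erase.1 hl).1)
  calc ∑ i : Fin k, siteEnergy lennardJones q i
      ≤ ∑ i : Fin k, -(2 / 25) * (((Finset.univ.erase i).filter fun l : Fin k =>
          39 / 40 ≤ dist (q i) (q l) ∧ dist (q i) (q l) ≤ 103 / 100).card : ℝ) := Finset.sum_le_sum fun i _ => h i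
    _ = _ := by rw [← Finset.mul_sum]; push_cast; rfl

/-- **Cross terms of `9/10`-clear holes (PROVED, GS-free):** `Σ_i Σ_m V(|q_i − y_m|) ≤ −(2/25)·P`, `P` the number of hole–particle
window contacts. -/
theorem cross_le_of_clear {k : ℕ} (q : Fin k → E3) (y : Fin N → E3) (hclear : ∀ (i : Fin k) (m : Fin N), 9 / 10 ≤ dist (q i) (y m)) :
    ∑ i : Fin k, ∑ m : Fin N, lennardJones (dist (q i) (y m)) ≤ -(2 / 25) *
      ((∑ i : Fin k, (Finset.univ.filter fun m : Fin N =>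
        39 / 40 ≤ dist (q i) (y m) ∧ dist (q i) (y m) ≤ 103 / 100).card : ℕ) : ℝ) := by
  calc ∑ i : Fin k, ∑ m : Fin N, lennardJones (dist (q i) (y m))
      ≤ ∑ i : Fin k, -(2 / 25) * ((Finset.univ.filter fun m : Fin N =>
          39 / 40 ≤ dist (q i) (y m) ∧ dist (q i) (y m) ≤ 103 / 100).card : ℝ) :=
        Finset.sum_le_sum fun i _ => insertion_le_of_clear (y := y) (q := q i) (hclear i)
    _ = _ := by rw [← Finset.mul_sum]; push_cast; rfl

/-! ## §3 A caged void is a local improvement -/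

/-- **A CAGED `k`-VOID is a radius-`R` improvement (PROVED, GS-free):** hole points `q : Fin k → E3`, `1 ≤ k ≤ ⌈64R³⌉`, each within `R`
of `y c`, each `9/10`-clear of all particles, pairwise `≥ 9/10` apart, with `20k ≤ 2P + D` (hole–particle window contacts `P` counted twice,
ordered hole–hole window contacts `D` once); then at any level `e ≥ −0.78647722` and margin `η ≤ 1/100`, filling the void (`Fin.append q y`)
is an improvement by `η` in the landed local-surgery currency about `y c`. -/
theorem improvable_of_cagedVoid {y : Fin N → E3} (hy : Function.Injective y) {R : ℝ} {c : Fin N}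
    {k : ℕ} {q : Fin k → E3} (hk : 1 ≤ k) (hkR : k ≤ ⌈64 * R ^ 3⌉₊)
    (hqc : ∀ i : Fin k, dist (q i) (y c) ≤ R) (hclear : ∀ (i : Fin k) (m : Fin N), 9 / 10 ≤ dist (q i) (y m))
    (hsep : ∀ i l : Fin k, i ≠ l → 9 / 10 ≤ dist (q i) (q l))
    (hcount : 20 * k ≤
      2 * ∑ i : Fin k, (Finset.univ.filter fun m : Fin N => 39 / 40 ≤ dist (q i) (y m) ∧ dist (q i) (y m) ≤ 103 / 100).card +
        ∑ i : Fin k, ((Finset.univ.erase i).filter fun l : Fin k => 39 / 40 ≤ dist (q i) (q l) ∧ dist (q i) (q l) ≤ 103 / 100).card)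
    {e η : ℝ} (he : -(98309653 / 125000000 : ℝ) ≤ e) (hη : η ≤ 1 / 100) :
    ∃ (M : ℕ) (z : Fin M → E3), Function.Injective z ∧
      (∀ m : Fin N, R < dist (y m) (y c) → y m ∈ Set.range z) ∧
      (∀ l : Fin M, R < dist (z l) (y c) → z l ∈ Set.range y) ∧
      N ≤ M + ⌈64 * R ^ 3⌉₊ ∧ M ≤ N + ⌈64 * R ^ 3⌉₊ ∧
      interactionEnergy lennardJones z + η ≤ interactionEnergy lennardJones y + e * ((M : ℝ) - N) := by
  -- the filled configuration: holes first, then the particles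
  have hqinj : Function.Injective q := by
    intro i l h
    by_contra hil
    have h' := hsep i l hil
    rw [h, dist_self] at h'
    norm_num at h'
  have hdisj : ∀ (i : Fin k) (m : Fin N), q i ≠ y m := by
    intro i m h
    have h' := hclear i m
    rw [h, dist_self] at h'
    norm_num at h'
  have hinj : Function.Injective (Fin.append q y) := Fin.append_injective_iff.2 ⟨hqinj, hy, hdisj⟩
  refine ⟨k + N, Fin.append q y, hinj, fun m _ => ⟨Fin.natAdd k m, Fin.append_right q y m⟩, fun l hl => ?_,
    by omega, by omega, ?_⟩
  · revert hl
    refine Fin.addCases (motive := fun l => R < dist (Fin.append q y l) (y c) → Fin.append q y l ∈ Set.range y)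
      (fun i hi => ?_) (fun m _ => ?_) l
    · rw [Fin.append_left] at hi
      exact absurd (hqc i) (not_le.2 hi)
    · exact ⟨m, (Fin.append_right q y m).symm⟩
  · -- the energy of the filled configuration
    have hE := interactionEnergy_append lennardJones lennardJones_zero q y
    have hself := two_mul_interactionEnergy_le_of_sep q hsep
    have hcross := cross_le_of_clear q y hclear
    have hcount' : (20 : ℝ) * k ≤
        2 * ((∑ i : Fin k, (Finset.univ.filter fun m : Fin N =>
          39 / 40 ≤ dist (q i) (y m) ∧ dist (q i) (y m) ≤ 103 / 100).card : ℕ) : ℝ) +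
        ((∑ i : Fin k, ((Finset.univ.erase i).filter fun l : Fin k =>
          39 / 40 ≤ dist (q i) (q l) ∧ dist (q i) (q l) ≤ 103 / 100).card : ℕ) : ℝ) := by
      exact_mod_cast hcount
    have hk' : (1 : ℝ) ≤ k := by exact_mod_cast hk
    have hcast : e * (((k + N : ℕ) : ℝ) - (N : ℝ)) = e * k := by push_cast; ring
    rw [hcast]
    have hek : -(98309653 / 125000000 : ℝ) * k ≤ e * k := mul_le_mul_of_nonneg_right he (by linarith)
    linarith

/-- **The particle budget is automatic from radius `1` on (PROVED):** pairwise `9/10`-separated points within `R ≥ 1` of a point number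
at most `⌈64R³⌉` (Literature's volume packing bound: `k ≤ (20R/9 + 1)³ ≤ (29/9)³R³ < 64R³`). -/
theorem holes_card_le {k : ℕ} {q : Fin k → E3} {p : E3} {R : ℝ} (hR : 1 ≤ R) (hqc : ∀ i : Fin k, dist (q i) p ≤ R)
    (hsep : ∀ i l : Fin k, i ≠ l → 9 / 10 ≤ dist (q i) (q l)) : k ≤ ⌈64 * R ^ 3⌉₊ := by
  have hqinj : Function.Injective q := by
    intro i l h
    by_contra hil
    have h' := hsep i l hil
    rw [h, dist_self] at h'
    norm_num at h'
  set s : Finset E3 := Finset.univ.image q with hs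
  have hcard : s.card = k := by
    rw [hs, Finset.card_image_of_injective _ hqinj, Finset.card_univ, Fintype.card_fin]
  have hmem : ∀ a ∈ s, ∃ i : Fin k, q i = a := fun a ha => by
    obtain ⟨i, -, hi⟩ := Finset.mem_image.1 ha
    exact ⟨i, hi⟩
  have h := card_le_of_separated_of_dist_le s p (r := 9 / 10) (R := R) (by norm_num) (by linarith)
    (fun a ha => by
      obtain ⟨i, rfl⟩ := hmem a ha
      exact hqc i)
    (fun a ha b hb hab => by
      obtain ⟨i, rfl⟩ := hmem a ha
      obtain ⟨l, rfl⟩ := hmem b hb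
      exact hsep i l fun hil => hab (by rw [hil]))
  rw [finrank_euclideanSpace_fin, hcard] at h
  have h1 : 2 * R / (9 / 10) + 1 ≤ 29 / 9 * R := by
    rw [div_eq_mul_inv]
    norm_num
    linarith
  have h0 : 0 ≤ 2 * R / (9 / 10) + 1 := by positivity
  have h3 : (2 * R / (9 / 10) + 1) ^ 3 ≤ (29 / 9 * R) ^ 3 := pow_le_pow_left₀ h0 h1 3
  have hR3 : 0 ≤ R ^ 3 := by positivity
  have hkR : (k : ℝ) ≤ 64 * R ^ 3 := by nlinarith
  have hceil : (64 * R ^ 3 : ℝ) ≤ (⌈64 * R ^ 3⌉₊ : ℝ) := Nat.le_ceil _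
  exact_mod_cast hkR.trans hceil

/-- **Per-hole form (PROVED):** if EVERY hole of the void is `20`-caged counting its particle contacts twice and its hole contacts once
(`20 ≤ 2P_i + D_i`: vacancy row site `2·10 + 2`, tetra-vacancy site `2·9 + 3`, octahedral 6-void site `2·8 + 4`), the void is caged. -/
theorem improvable_of_cagedVoid_perHole {y : Fin N → E3} (hy : Function.Injective y) {R : ℝ} (hR : 1 ≤ R) {c : Fin N}
    {k : ℕ} {q : Fin k → E3} (hk : 1 ≤ k)
    (hqc : ∀ i : Fin k, dist (q i) (y c) ≤ R) (hclear : ∀ (i : Fin k) (m : Fin N), 9 / 10 ≤ dist (q i) (y m))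
    (hsep : ∀ i l : Fin k, i ≠ l → 9 / 10 ≤ dist (q i) (q l))
    (hcount : ∀ i : Fin k, 20 ≤
      2 * (Finset.univ.filter fun m : Fin N => 39 / 40 ≤ dist (q i) (y m) ∧ dist (q i) (y m) ≤ 103 / 100).card +
        ((Finset.univ.erase i).filter fun l : Fin k => 39 / 40 ≤ dist (q i) (q l) ∧ dist (q i) (q l) ≤ 103 / 100).card)
    {e η : ℝ} (he : -(98309653 / 125000000 : ℝ) ≤ e) (hη : η ≤ 1 / 100) :
    ∃ (M : ℕ) (z : Fin M → E3), Function.Injective z ∧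
      (∀ m : Fin N, R < dist (y m) (y c) → y m ∈ Set.range z) ∧
      (∀ l : Fin M, R < dist (z l) (y c) → z l ∈ Set.range y) ∧
      N ≤ M + ⌈64 * R ^ 3⌉₊ ∧ M ≤ N + ⌈64 * R ^ 3⌉₊ ∧
      interactionEnergy lennardJones z + η ≤ interactionEnergy lennardJones y + e * ((M : ℝ) - N) := by
  refine improvable_of_cagedVoid hy hk (holes_card_le hR hqc hsep) hqc hclear hsep ?_ he hη
  have h := Finset.sum_le_sum fun i (_ : i ∈ (Finset.univ : Finset (Fin k))) => hcount i
  rw [Finset.sum_const, Finset.card_univ, Fintype.card_fin, smul_eq_mul, Finset.sum_add_distrib, ← Finset.mul_sum] at h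
  simpa [mul_comm] using h

/-! ## §4 The order-`k` rung of the NEAR surgery floor (sequence level, GS-free) -/

/-- **VOID RUNG (PROVED, GS-free):** for every sequence of injective configurations, with margin `η = 1/100`, from radius `1` on, at every
index: a CAGED VOID (any number `k ≥ 1` of holes, thresholds certified, budget automatic) within `R` of some particle makes the configuration
radius-`R` IMPROVABLE by `η` about that particle, at the level `e = lim E(N)/N`.  The statement is the line's `FloorEvI x trig` unfolded, for
`trig R N y := ∃ c, «caged void within R of y c»`. -/
theorem void_floor (x : (N : ℕ) → (Fin N → E3)) (hx : ∀ N, Function.Injective (x N)) :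
    ∃ η R₁ : ℝ, 0 < η ∧ ∀ e : ℝ, Tendsto (fun N : ℕ => groundStateEnergy lennardJones 3 N / N) atTop (𝓝 e) →
      ∀ R : ℝ, R₁ ≤ R → ∀ᶠ N in atTop,
        (∃ (c : Fin N) (k : ℕ) (q : Fin k → E3), 1 ≤ k ∧ (∀ i : Fin k, dist (q i) (x N c) ≤ R) ∧
          (∀ (i : Fin k) (m : Fin N), 9 / 10 ≤ dist (q i) (x N m)) ∧ (∀ i l : Fin k, i ≠ l → 9 / 10 ≤ dist (q i) (q l)) ∧
          20 * k ≤
            2 * ∑ i : Fin k, (Finset.univ.filter fun m : Fin N =>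
                39 / 40 ≤ dist (q i) (x N m) ∧ dist (q i) (x N m) ≤ 103 / 100).card +
              ∑ i : Fin k, ((Finset.univ.erase i).filter fun l : Fin k =>
                39 / 40 ≤ dist (q i) (q l) ∧ dist (q i) (q l) ≤ 103 / 100).card) →
        ∃ (c : Fin N) (M : ℕ) (z : Fin M → E3), Function.Injective z ∧
          (∀ m : Fin N, R < dist (x N m) (x N c) → x N m ∈ Set.range z) ∧
          (∀ l : Fin M, R < dist (z l) (x N c) → z l ∈ Set.range (x N)) ∧
          N ≤ M + ⌈64 * R ^ 3⌉₊ ∧ M ≤ N + ⌈64 * R ^ 3⌉₊ ∧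
          interactionEnergy lennardJones z + 1 / 100 ≤ interactionEnergy lennardJones (x N) + e * ((M : ℝ) - N) := by
  refine ⟨1 / 100, 1, by norm_num, fun e he R hR => Filter.Eventually.of_forall fun N hdef => ?_⟩
  obtain ⟨c, k, q, hk, hqc, hclear, hsep, hcount⟩ := hdef
  exact ⟨c, improvable_of_cagedVoid (hx N) hk (holes_card_le hR hqc hsep) hqc hclear hsep hcount
    (twoConeB_le_of_tendsto he) le_rfl⟩

/-! ## §5 The μ-seat reading: μ-rigid configurations carry no caged void -/

/-- **VOIDS OF A μ-STABLE CONFIGURATION ARE UNDER-CAGED (PROVED, GS-free, certified constants):** at an injective configuration that is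
`(e, 1/(j+1), j)`-μ-stable with `⌈64R³⌉ ≤ j`, `100 ≤ j`, `e` a limit of `E(N)/N`, every family of `k` holes (`1 ≤ k ≤ ⌈64R³⌉`) within `R`
of a particle, `9/10`-clear and pairwise `9/10`-separated, has `2P + D < 20k`.  (`k = 1`: the landed `cagedCount_le_of_muStable`, `P ≤ 9`.) -/
theorem twoP_add_D_lt_of_muStable {e : ℝ} (he : Tendsto (fun N : ℕ => groundStateEnergy lennardJones 3 N / N) atTop (𝓝 e))
    {R : ℝ} {j : ℕ} (hjR : ⌈64 * R ^ 3⌉₊ ≤ j) (hj : 100 ≤ j) {y : Fin N → E3} (hy : Function.Injective y)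
    (hM : ∀ M : ℕ, N ≤ M + j → M ≤ N + j → ∀ z : Fin M → E3, Function.Injective z →
      interactionEnergy lennardJones y + e * ((M : ℝ) - N) - 1 / ((j : ℝ) + 1) ≤ interactionEnergy lennardJones z)
    (c : Fin N) {k : ℕ} {q : Fin k → E3} (hk : 1 ≤ k) (hkR : k ≤ ⌈64 * R ^ 3⌉₊)
    (hqc : ∀ i : Fin k, dist (q i) (y c) ≤ R) (hclear : ∀ (i : Fin k) (m : Fin N), 9 / 10 ≤ dist (q i) (y m))
    (hsep : ∀ i l : Fin k, i ≠ l → 9 / 10 ≤ dist (q i) (q l)) :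
    2 * ∑ i : Fin k, (Finset.univ.filter fun m : Fin N => 39 / 40 ≤ dist (q i) (y m) ∧ dist (q i) (y m) ≤ 103 / 100).card +
        ∑ i : Fin k, ((Finset.univ.erase i).filter fun l : Fin k => 39 / 40 ≤ dist (q i) (q l) ∧ dist (q i) (q l) ≤ 103 / 100).card
      < 20 * k := by
  by_contra hnot
  have hcount := not_lt.1 hnot
  have hεη : 1 / ((j : ℝ) + 1) < 1 / 100 := by
    have hj' : (100 : ℝ) ≤ j := by exact_mod_cast hj
    rw [div_lt_div_iff₀ (by positivity) (by norm_num)]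
    linarith
  exact not_improvable_of_muStable hM hjR hεη c
    (improvable_of_cagedVoid hy hk hkR hqc hclear hsep hcount (twoConeB_le_of_tendsto he) le_rfl)

/-- **μ-SEAT OF THE VOID RUNG (PROVED, GS-free) — the line's `RigidNearPocket0` on the caged-void class, at EVERY test radius and EVERY
index:** along any sequence of injective configurations, for every `R ≥ 1` and every limit level `e`, at the order `j₀ = max ⌈64R³⌉ 100`,
an `(e, 1/(j₀+1), j₀)`-μ-stable `x N` carries NO caged void within `R` of any particle. -/
theorem rigid_void_seat (x : (N : ℕ) → (Fin N → E3)) (hx : ∀ N, Function.Injective (x N)) :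
    ∀ R : ℝ, 1 ≤ R → ∀ e : ℝ, Tendsto (fun N : ℕ => groundStateEnergy lennardJones 3 N / N) atTop (𝓝 e) →
      ∃ j₀ : ℕ, ∀ N : ℕ,
        (∀ M : ℕ, N ≤ M + j₀ → M ≤ N + j₀ → ∀ z : Fin M → E3, Function.Injective z →
          interactionEnergy lennardJones (x N) + e * ((M : ℝ) - N) - 1 / ((j₀ : ℝ) + 1) ≤ interactionEnergy lennardJones z) →
        ¬ ∃ (c : Fin N) (k : ℕ) (q : Fin k → E3), 1 ≤ k ∧ (∀ i : Fin k, dist (q i) (x N c) ≤ R) ∧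
          (∀ (i : Fin k) (m : Fin N), 9 / 10 ≤ dist (q i) (x N m)) ∧ (∀ i l : Fin k, i ≠ l → 9 / 10 ≤ dist (q i) (q l)) ∧
          20 * k ≤
            2 * ∑ i : Fin k, (Finset.univ.filter fun m : Fin N =>
                39 / 40 ≤ dist (q i) (x N m) ∧ dist (q i) (x N m) ≤ 103 / 100).card +
              ∑ i : Fin k, ((Finset.univ.erase i).filter fun l : Fin k =>
                39 / 40 ≤ dist (q i) (q l) ∧ dist (q i) (q l) ≤ 103 / 100).card := by
  intro R hR e he
  refine ⟨max ⌈64 * R ^ 3⌉₊ 100, fun N hM => ?_⟩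
  rintro ⟨c, k, q, hk, hqc, hclear, hsep, hcount⟩
  have h := twoP_add_D_lt_of_muStable he (le_max_left _ _) (le_max_right _ _) (hx N) hM c hk
    (holes_card_le hR hqc hsep) hqc hclear hsep
  omega

/-! ## §6 The other Kossel relation under the sharper level `e ≤ −0.7175`: warm sites are excluded -/

/-- **EVERY PARTICLE OF A μ-RIGID CONFIGURATION BINDS BY MORE THAN `0.7175 − ε` (PROVED modulo the level input `e ≤ −0.7175`):**
μ-stability of any order `j ≥ 1` with tolerance `ε` at a level `e ≤ −0.7175` bounds every site energy by `−0.7175 + ε`.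
(In the tree `e = e⋆` — `LoopTunnelDialCurrencyBridge.e_eq_eStar` — and `e⋆ ≤ −0.7175` — `OnePercentFccWindow.eStar_le`, a `native_decide`
certificate; the input is kept as a hypothesis so that this file's axiom closure stays on the whitelist.) -/
theorem siteEnergy_le_of_muStable_of_level {e ε : ℝ} {j : ℕ} {y : Fin N → E3}
    (hM : ∀ M : ℕ, N ≤ M + j → M ≤ N + j → ∀ z : Fin M → E3, Function.Injective z →
      interactionEnergy lennardJones y + e * ((M : ℝ) - N) - ε ≤ interactionEnergy lennardJones z)
    (hj : 1 ≤ j) (hy : Function.Injective y) (hE : e ≤ -(7175 / 10000)) (i : Fin N) :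
    siteEnergy lennardJones y i ≤ -(7175 / 10000) + ε := by
  have h := (kinkBalanced_of_muStable hM hj hy).1 i
  linarith

/-- **WARM SITES are radius-`R` improvements under the sharper level (PROVED modulo `e ≤ −0.7175`):** a particle `i` within `R` of `y c`
with site energy `≥ −0.7075` is deletable with margin `1/100` (order one reached only `𝓔ⁱ ≥ 1/100`, from `e ≤ 0`). -/
theorem improvable_of_warmSite {y : Fin N → E3} (hy : Function.Injective y) {R : ℝ} (hR : 0 < R) {i c : Fin N}
    (hic : dist (y i) (y c) ≤ R) (hwarm : -(7075 / 10000 : ℝ) ≤ siteEnergy lennardJones y i)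
    {e η : ℝ} (hE : e ≤ -(7175 / 10000)) (hη : η ≤ 1 / 100) :
    ∃ (M : ℕ) (z : Fin M → E3), Function.Injective z ∧
      (∀ k : Fin N, R < dist (y k) (y c) → y k ∈ Set.range z) ∧
      (∀ l : Fin M, R < dist (z l) (y c) → z l ∈ Set.range y) ∧
      N ≤ M + ⌈64 * R ^ 3⌉₊ ∧ M ≤ N + ⌈64 * R ^ 3⌉₊ ∧
      interactionEnergy lennardJones z + η ≤ interactionEnergy lennardJones y + e * ((M : ℝ) - N) :=
  improvable_of_le_siteEnergy hy hR hic (by linarith)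

end Summit.AtomisticToContinuum.Crystallization.Theorems.LoopTunnelDialVoidRung
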